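import Literature.MathematicalPhysics.QuantumFieldTheory.Federbush1986.PhaseCellIVThmA4Retract

/-!
# `Federbush1986.PhaseCellIVThmA3Sphere` — [Federbush1988PhaseCellIV] Appendix A, **Theorems A.3 and A.4** (capped forms, decls of
# record `PhaseCellIVAppA.ThmA3ContCap` / `ThmA4ContCap`) for the MODEL TARGETS `M = S^{t−1} ⊂ R^t` (unit spheres:
# `SU(2) = S³ ⊂ ℍ = R⁴`, `U(1) = S¹ ⊂ R²`) — PROVED with no hypothesis, the normal projection `Pr_M(y) = y/|y|` being explicit

statement-level skeleton of published theorems with citation tags; proofs where landed; nothing here is a claim about the Yang–Mills mass gap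

CITATION HEADER.  P. Federbush, *A phase cell approach to Yang–Mills theory. IV. The choice of variables*, Commun. Math.
Phys. **114** (1988) 317–343 [Federbush1988PhaseCellIV], Appendix A part C, Theorem A.3 and its proof (A.27)–(A.31) p. 342;
p. 339 «Caution».  Cell `lit-balaban`, Phase-2 proof seat **p04 gen 7**; SKELETON row **F4.ThmA.3** (decl of record
`PhaseCellIVAppA.ThmA3ContCap`, p251889; fold owner r19) and row **F4.ThmA.4** (`ThmA4ContCap`, Theorem A.4 p. 343).  Inputs BY
NAME: `PhaseCellIVAppA.Retract.thmA3ContCap_of_retract` (`PhaseCellIVThmA3Retract`) and `thmA4ContCap_of_retract`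
(`PhaseCellIVThmA4Retract`), this seat: Theorems A.3 / A.4 for every uniformly smoothly retractable target.

WHAT IS PRINTED (p. 342): «`f^s_ε(x) = Pr_M(f^{s′}_ε(x))` (A.31), where `Pr_M` is the projection onto `M`, using the normal
bundle to `M`, and defined in a neighborhood of `M`.»  For the model group manifolds of the series — `G = SU(2)` (Bałaban CMP
109 Thm 2, the cell's standard model instance) is the unit sphere `S³` of `ℍ = R⁴`, the abelian `U(1)` is `S¹ ⊂ R²` — the
normal projection is the EXPLICIT map `y ↦ y/|y|` on `{|y| > 0}`.  THIS FILE builds a global `C^∞` map `sphereRetraction`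
(`= smoothTransition(8|y|² − 1)·y/|y|`, i.e. `y/|y|` for `|y| ≥ ½` and `0` near the origin), checks the four retraction
hypotheses of `thmA3ContCap_of_retract` with `r = ½` (values in the sphere and bounded derivatives on `{d(y, S^{t−1}) < ½} ⊆
{½ < |y| < 3/2}`, identity on the sphere), and concludes **`thmA3ContCap_sphere : ThmA3ContCap n t (sphere 0 1)` for ALL
`n, t`** (for `t = 0` the sphere is empty and the statement is vacuous), and likewise **`thmA4ContCap_sphere : ThmA4ContCap n t
(sphere 0 1)`** (Theorem A.4, punctured ball).  Corollaries by name: `thmA3ContCap_circle` / `thmA4ContCap_circle` (`t = 2`,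
`U(1)`), `thmA3ContCap_threeSphere` / `thmA4ContCap_threeSphere` (`t = 4`, `SU(2)`).

WHAT THIS MODULE PROVIDES (namespace `PhaseCellIVAppA.Retract`): def with body `sphereRetraction`; theorems
`sphereRetraction_eq_of_le`, `sphereRetraction_eq_zero_of_le`, `contDiff_sphereRetraction`, `norm_gt_of_infDist_lt`,
`norm_lt_of_infDist_lt`, `sphereRetraction_mem_sphere`, `sphereRetraction_eq_self`, `exists_bound_iteratedFDeriv_sphereRetraction`,
**`thmA3ContCap_sphere`**, `thmA3ContCap_circle`, `thmA3ContCap_threeSphere`, **`thmA4ContCap_sphere`**, `thmA4ContCap_circle`,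
`thmA4ContCap_threeSphere`.  No `Prop`-valued definition, no named fact; axioms standard.
-/

namespace Literature.MathematicalPhysics.QuantumFieldTheory.Federbush1986

noncomputable section

open Metric Set Filter Function Real
open scoped ContDiff Topology NNReal

namespace PhaseCellIVAppA

namespace Retract

open LipschitzMollifier

variable {t : ℕ}

/-! ## §1 The explicit normal projection onto the unit sphere, cut off near the origin -/

/-- `Pr_{S^{t−1}}` made global: `sphereRetraction y = smoothTransition(8|y|² − 1)·(y/|y|)` — equal to the normal projection
`y/|y|` for `|y|² ≥ ¼`, and to `0` for `|y|² ≤ ⅛`. [cite: Federbush1988PhaseCellIV, (A.31) p. 342] -/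
def sphereRetraction (t : ℕ) (y : Euc t) : Euc t := smoothTransition (8 * ‖y‖ ^ 2 - 1) • (‖y‖⁻¹ • y)

/-- For `|y|² ≥ ¼` the retraction is the normal projection `y/|y|`. [cite: Federbush1988PhaseCellIV, (A.31) p. 342] -/
theorem sphereRetraction_eq_of_le {y : Euc t} (hy : 1 / 4 ≤ ‖y‖ ^ 2) : sphereRetraction t y = ‖y‖⁻¹ • y := by
  unfold sphereRetraction
  rw [smoothTransition.one_of_one_le (by linarith), one_smul]

/-- For `|y|² ≤ ⅛` the retraction vanishes. [cite: Federbush1988PhaseCellIV, (A.31) p. 342] -/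
theorem sphereRetraction_eq_zero_of_le {y : Euc t} (hy : ‖y‖ ^ 2 ≤ 1 / 8) : sphereRetraction t y = 0 := by
  unfold sphereRetraction
  rw [smoothTransition.zero_of_nonpos (by linarith), zero_smul]

/-- `sphereRetraction ∈ C^∞(R^t)` (smooth away from `0`, identically `0` near `0`). [cite: Federbush1988PhaseCellIV, (A.31)
p. 342] -/
theorem contDiff_sphereRetraction : ContDiff ℝ ∞ (sphereRetraction t) := by
  rw [contDiff_iff_contDiffAt]
  intro y
  by_cases hy : y = 0
  · subst hy
    have hev : sphereRetraction t =ᶠ[𝓝 (0 : Euc t)] fun _ => 0 := by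
      have hopen : IsOpen {z : Euc t | ‖z‖ ^ 2 < 1 / 8} := isOpen_lt (continuous_norm.pow 2) continuous_const
      filter_upwards [hopen.mem_nhds (by simp)] with z hz using sphereRetraction_eq_zero_of_le (le_of_lt hz)
    exact contDiffAt_const.congr_of_eventuallyEq hev
  · have h1 : ContDiffAt ℝ ∞ (fun z : Euc t => smoothTransition (8 * ‖z‖ ^ 2 - 1)) y :=
      smoothTransition.contDiffAt.comp y (((contDiffAt_id.norm_sq ℝ).const_smul (8 : ℝ)).sub contDiffAt_const)
    have h2 : ContDiffAt ℝ ∞ (fun z : Euc t => ‖z‖⁻¹) y := (contDiffAt_norm ℝ hy).inv (norm_ne_zero_iff.2 hy)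
    have h3 : ContDiffAt ℝ ∞ (fun z : Euc t => ‖z‖⁻¹ • z) y := h2.smul contDiffAt_id
    exact h1.smul h3

/-! ## §2 The retraction hypotheses on the `½`-neighbourhood of the sphere -/

/-- `d(y, S^{t−1}) < ½` forces `|y| > ½`. [cite: Federbush1988PhaseCellIV, (A.31) p. 342] -/
theorem norm_gt_of_infDist_lt (hS : (sphere (0 : Euc t) 1).Nonempty) {y : Euc t} (hy : infDist y (sphere (0 : Euc t) 1) < 1 / 2) :
    1 / 2 < ‖y‖ := by
  obtain ⟨z, hz, hyz⟩ := (infDist_lt_iff hS).1 hy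
  rw [mem_sphere, dist_zero_right] at hz
  rw [dist_eq_norm] at hyz
  have := norm_sub_norm_le z y
  rw [norm_sub_rev] at this
  linarith

/-- `d(y, S^{t−1}) < ½` forces `|y| < 3/2`. [cite: Federbush1988PhaseCellIV, (A.31) p. 342] -/
theorem norm_lt_of_infDist_lt (hS : (sphere (0 : Euc t) 1).Nonempty) {y : Euc t} (hy : infDist y (sphere (0 : Euc t) 1) < 1 / 2) :
    ‖y‖ < 3 / 2 := by
  obtain ⟨z, hz, hyz⟩ := (infDist_lt_iff hS).1 hy
  rw [mem_sphere, dist_zero_right] at hz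
  rw [dist_eq_norm] at hyz
  have := norm_le_norm_sub_add y z
  linarith

/-- On the `½`-neighbourhood the retraction lands in the sphere. [cite: Federbush1988PhaseCellIV, (A.31) p. 342] -/
theorem sphereRetraction_mem_sphere (hS : (sphere (0 : Euc t) 1).Nonempty) {y : Euc t}
    (hy : infDist y (sphere (0 : Euc t) 1) < 1 / 2) : sphereRetraction t y ∈ sphere (0 : Euc t) 1 := by
  have h1 := norm_gt_of_infDist_lt hS hy
  have hpos : 0 < ‖y‖ := by linarith
  rw [sphereRetraction_eq_of_le (by nlinarith), mem_sphere, dist_zero_right, norm_smul, norm_inv, norm_norm,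
    inv_mul_cancel₀ hpos.ne']

/-- The retraction is the identity on the sphere. [cite: Federbush1988PhaseCellIV, (A.31) p. 342] -/
theorem sphereRetraction_eq_self {y : Euc t} (hy : y ∈ sphere (0 : Euc t) 1) : sphereRetraction t y = y := by
  rw [mem_sphere, dist_zero_right] at hy
  rw [sphereRetraction_eq_of_le (by rw [hy]; norm_num), hy, inv_one, one_smul]

/-- Each derivative of the retraction is bounded on the `½`-neighbourhood of the sphere (continuity on the compact annulus
`½ ≤ |y| ≤ 3/2`). [cite: Federbush1988PhaseCellIV, (A.26)/(A.31) p. 342] -/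
theorem exists_bound_iteratedFDeriv_sphereRetraction (hS : (sphere (0 : Euc t) 1).Nonempty) (i : ℕ) :
    ∃ C : ℝ, ∀ y : Euc t, infDist y (sphere (0 : Euc t) 1) < 1 / 2 → ‖iteratedFDeriv ℝ i (sphereRetraction t) y‖ ≤ C := by
  have hK : IsCompact (closedBall (0 : Euc t) (3 / 2) \ ball (0 : Euc t) (1 / 2)) := (isCompact_closedBall _ _).diff isOpen_ball
  obtain ⟨C, hC⟩ := hK.exists_bound_of_continuousOn
    ((contDiff_sphereRetraction.continuous_iteratedFDeriv (m := i) (mod_cast le_top)).continuousOn)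
  refine ⟨C, fun y hy => hC y ⟨?_, ?_⟩⟩
  · rw [mem_closedBall, dist_zero_right]; exact (norm_lt_of_infDist_lt hS hy).le
  · rw [mem_ball, dist_zero_right, not_lt]; exact (norm_gt_of_infDist_lt hS hy).le

/-! ## §3 Theorem A.3 (capped form) for sphere targets -/

/-- **Theorem A.3 of [Federbush1988PhaseCellIV] (decl of record `ThmA3ContCap`, p. 339 «Caution» cap) for the unit sphere
`M = S^{t−1} ⊂ R^t`, every `n` and every `t`** — the cell's model targets `SU(2) = S³ ⊂ ℍ` (`t = 4`) and `U(1) = S¹` (`t = 2`):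
for every cap `c₁` there are constants `c_m` such that every `f : B → S^{t−1}` with `Λ₁(f) ≤ c₁` has an `f^s : B → S^{t−1}`,
`f^s = f` on `∂B`, continuous on `B`, `C^∞` inside, with `‖D^m f^s(x)‖ ≤ c_m d(x, ∂B)^{−(m−1)} Λ₁(f)`.  NO hypothesis: the normal
projection is the explicit `y ↦ y/|y|`. [cite: Federbush1988PhaseCellIV, Theorem A.3 (A.25)–(A.26), (A.31) p. 342; «Caution»
p. 339] -/
theorem thmA3ContCap_sphere (n t : ℕ) : ThmA3ContCap n t (sphere (0 : EuclideanSpace ℝ (Fin t)) 1) := by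
  by_cases hS : (sphere (0 : Euc t) 1).Nonempty
  · exact thmA3ContCap_of_retract (P := sphereRetraction t) (r := 1 / 2) (by norm_num) contDiff_sphereRetraction
      (fun y hy => sphereRetraction_mem_sphere hS hy) (fun y hy => sphereRetraction_eq_self hy)
      (fun i => exists_bound_iteratedFDeriv_sphereRetraction hS i) n
  · -- `t = 0`: the sphere is empty, there is no `f : B → ∅` (the ball contains `0`), the statement is vacuous
    intro c₁
    refine ⟨fun _ => 0, fun f _ => ?_⟩
    exact absurd ⟨_, (f ⟨0, mem_closedBall_self zero_le_one⟩).2⟩ hS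

/-- **The abelian model target `U(1) = S¹ ⊂ R²`.** [cite: Federbush1988PhaseCellIV, Theorem A.3 p. 342] -/
theorem thmA3ContCap_circle (n : ℕ) : ThmA3ContCap n 2 (sphere (0 : EuclideanSpace ℝ (Fin 2)) 1) :=
  thmA3ContCap_sphere n 2

/-- **The model target `SU(2) = S³ ⊂ ℍ = R⁴`** (the cell's standard model instance of the group manifold).
[cite: Federbush1988PhaseCellIV, Theorem A.3 p. 342] -/
theorem thmA3ContCap_threeSphere (n : ℕ) : ThmA3ContCap n 4 (sphere (0 : EuclideanSpace ℝ (Fin 4)) 1) :=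
  thmA3ContCap_sphere n 4

/-! ## §4 Theorem A.4 (capped form) for sphere targets -/

/-- **Theorem A.4 of [Federbush1988PhaseCellIV] (decl of record `ThmA4ContCap`, p. 339 «Caution» cap) for the unit sphere
`M = S^{t−1} ⊂ R^t`, every `n` and every `t`** (`SU(2) = S³`, `U(1) = S¹`): for every cap `c₁` there are constants `c_m` such that
for every centre `x₀` every Lipschitz `f : ∂B → S^{t−1}` with `Λ₁(f) ≤ c₁` has an `f^{es} : B − x₀ → S^{t−1}`, `= f` on `∂B`,
continuous, `C^∞` on the open punctured ball, with `‖D^m f^{es}(x)‖ ≤ c_m d(x, ∂B ∪ x₀)^{−(m−1)} |x − x₀|^{−1} Λ₁(f)`.  NO hypothesis.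
[cite: Federbush1988PhaseCellIV, Theorem A.4 (A.34)–(A.36) p. 343; (A.31) p. 342; «Caution» p. 339] -/
theorem thmA4ContCap_sphere (n t : ℕ) : ThmA4ContCap n t (sphere (0 : EuclideanSpace ℝ (Fin t)) 1) := by
  by_cases hS : (sphere (0 : Euc t) 1).Nonempty
  · exact thmA4ContCap_of_retract (P := sphereRetraction t) (r := 1 / 2) (by norm_num) contDiff_sphereRetraction
      (fun y hy => sphereRetraction_mem_sphere hS hy) (fun y hy => sphereRetraction_eq_self hy)
      (fun i => exists_bound_iteratedFDeriv_sphereRetraction hS i) n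
  · -- `t = 0`: the target sphere is empty; a datum `f : ∂B → ∅` exists only if `∂B = ∅`, i.e. the source space is the point
    -- `{x₀}`, and then `B − x₀ = ∅`: every clause is vacuous
    intro c₁
    refine ⟨fun _ => 0, fun x₀ f _ => ?_⟩
    have hpt : ∀ y : Euc n, y = x₀ := by
      intro y
      by_contra hy
      have hy0 : y - x₀ ≠ 0 := sub_ne_zero.2 hy
      have hmem : x₀ + ‖y - x₀‖⁻¹ • (y - x₀) ∈ sphere x₀ 1 := by
        rw [mem_sphere, dist_eq_norm, add_sub_cancel_left, norm_smul, norm_inv, norm_norm,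
          inv_mul_cancel₀ (norm_ne_zero_iff.2 hy0)]
      exact hS ⟨_, (f ⟨_, hmem⟩).2⟩
    have hempty : ∀ S : Set (Euc n), S \ {x₀} = ∅ := fun S =>
      eq_empty_of_forall_notMem fun y hy => hy.2 (mem_singleton_iff.2 (hpt y))
    refine ⟨fun _ => 0, ?_, fun x => absurd ⟨_, (f x).2⟩ hS, ?_, ?_, fun m _ K _ _ x hx => ?_⟩
    · rw [hempty]; exact mapsTo_empty _ _
    · rw [hempty]; exact continuousOn_empty _
    · rw [hempty]; exact contDiffOn_empty
    · rw [hempty] at hx; exact absurd hx (notMem_empty _)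

/-- **Theorem A.4 for the abelian model target `U(1) = S¹ ⊂ R²`.** [cite: Federbush1988PhaseCellIV, Theorem A.4 p. 343] -/
theorem thmA4ContCap_circle (n : ℕ) : ThmA4ContCap n 2 (sphere (0 : EuclideanSpace ℝ (Fin 2)) 1) :=
  thmA4ContCap_sphere n 2

/-- **Theorem A.4 for the model target `SU(2) = S³ ⊂ ℍ = R⁴`.** [cite: Federbush1988PhaseCellIV, Theorem A.4 p. 343] -/
theorem thmA4ContCap_threeSphere (n : ℕ) : ThmA4ContCap n 4 (sphere (0 : EuclideanSpace ℝ (Fin 4)) 1) :=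
  thmA4ContCap_sphere n 4

end Retract

end PhaseCellIVAppA

end

end Literature.MathematicalPhysics.QuantumFieldTheory.Federbush1986
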